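import Mathlib
import HarnessLib
import Literature.Probability.MarkovChains.PeskunOrdering
import Literature.Probability.MarkovChains.MengersenTweedie
import Literature.Probability.MarkovChains.MultipleTryIndependenceSampler
import Literature.Probability.MarkovChains.ISIRUniformErgodicity

/-!
# A reversible kernel minorised by its target, `P(x, ·) ≥ ε π(·)`, has asymptotic variance at most
# `(2ε⁻¹ − 1) · var_π(f)` — Andrieu–Lee–Vihola's variance bound for i-SIR (finite state spaces)

[cite: AndrieuLeeVihola2018, §3 Theorem 1 (for `N ≥ 2` the kernel `P_N` "is reversible with
respect to `π` …", "`P_N(x,S) ≥ ε_N π(S)`" and "for any `f ∈ L²(X, π)`,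
`var_π(f) ≤ var(f, P_N) ≤ [2ε_N⁻¹ − 1] var_π(f)`"; proof: "follow from Corollary … and
[supplement], which gathers generic results on `π`-invariant Markov chains satisfying the
minorization"); §1 (third bullet, the i-SIR case `T = 1`:
`var(f, P_N) ≤ [2(1 + (2Ḡ−1)/(N−1)) − 1] var_π(f)`)]

The generic step behind the upper variance bound of Andrieu–Lee–Vihola's Theorem 1, on a finite
state space and in the vocabulary of `PeskunOrdering.lean` (`asympVar f π P` = Peskun's
`v(f, π, P) = lim N · var` of the ergodic average, `dirichletForm`, `limitMatrix π` = independent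
sampling `A = 1ᵀπ`): if `P` is `π`-reversible and `P(x, y) ≥ ε π(y)` for all `x, y`, then the
Dirichlet form of `P` dominates that of the LAZY INDEPENDENT SAMPLER `R_ε = ε A + (1 − ε) I`
(which moves to a fresh draw from `π` with probability `ε`), so by the Dirichlet-form version of
Peskun's theorem (`asympVar_le_of_dirichletForm_le`) `v(f, π, P) ≤ v(f, π, R_ε)`, and
`v(f, π, R_ε) = (2/ε − 1) var_π(f)` by Kemeny–Snell's formula (fundamental matrix
`Z = ε⁻¹ I + (1 − ε⁻¹) A`).

## Content

* `limitMatrix_mul_self` — `A² = A` (`Σ π = 1`).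
* `fundamentalMatrix_lazyIndep` — `Z(R_ε) = ε⁻¹ I + (1 − ε⁻¹) A`;
  `asympVar_lazyIndep` — `v(f, π, R_ε) = (2ε⁻¹ − 1) · var_π(f)`.
* **`asympVar_le_of_minorized`** — THE GENERIC BOUND: `π > 0`, `Σ π = 1`, `P` row-stochastic and
  `π`-reversible, `ε > 0`, `P(x,y) ≥ ε π(y)` for all `x, y` ⟹
  `v(f, π, P) ≤ (2ε⁻¹ − 1) · var_π(f)` for every `f`.
* **`asympVar_isir_le`** — Andrieu–Lee–Vihola's bound for i-SIR with `n + 1` fresh proposals and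
  weights `≤ W`: `v(f, p, P_N) ≤ (2(2W + n)/(n + 1) − 1) · var_p(f)`
  (`ε_N = (n+1)/(2W+n)`, `ISIRUniformErgodicity.isirKernel_minorized`).
* `asympVar_mtmis_le`, `asympVar_imh_le` — the same generic bound fed with the tree's
  minorisations of MTM-IS(`n+1`) (`ε = H_{n+1}(W)`, Yang–Liu) and of the Metropolized
  independence sampler (`ε = 1/W`, Mengersen–Tweedie): `v ≤ (2/H_{n+1}(W) − 1) var_p(f)` and
  `v ≤ (2W − 1) var_p(f)`.

NOT CLAIMED: the lower bound `var_π(f) ≤ var(f, P_N)` (it rests on positivity of `P_N`, the first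
bullet of the cited theorem, not typed here); general state spaces; the `L²` rate bullet.
-/

namespace Literature.Probability.MarkovChains

open Finset Matrix

variable {X : Type*} [Fintype X] [DecidableEq X] {π : X → ℝ}

/-! ## The lazy independent sampler `R_ε = ε A + (1 − ε) I` -/

omit [DecidableEq X] in
/-- `A² = A` for the limiting matrix of a probability vector. [cite: Peskun1973, §2.1
(Definition 2.1.1, `A = lim Pⁿ`, so `A` is idempotent)] -/
theorem limitMatrix_mul_self (hπ1 : ∑ x, π x = 1) :
    limitMatrix π * limitMatrix π = limitMatrix π := by
  ext x y
  simp only [mul_apply, limitMatrix, of_apply]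
  rw [← sum_mul, hπ1, one_mul]

omit [DecidableEq X] in
/-- `(A v)_x = Σ_y π_y v_y`. [cite: Peskun1973, §2.1 Definition 2.1.1] -/
theorem limitMatrix_mulVec_apply (π v : X → ℝ) (x : X) :
    (limitMatrix π *ᵥ v) x = ∑ y, π y * v y := by
  simp [limitMatrix, mulVec, dotProduct]

omit [Fintype X] in
/-- Entries of the lazy independent sampler: `R_ε(x, y) = ε π(y) + (1 − ε) 1{x = y}`.
[cite: AndrieuLeeVihola2018, §3 Theorem 1 (proof, "generic results on `π`-invariant Markov chains
satisfying the minorization")] -/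
theorem lazyIndep_apply (π : X → ℝ) (ε : ℝ) (x y : X) :
    (ε • limitMatrix π + (1 - ε) • (1 : Matrix X X ℝ)) x y =
      ε * π y + (1 - ε) * (if x = y then 1 else 0) := by
  simp [limitMatrix, one_apply]

/-- The lazy independent sampler is a stochastic matrix for `0 ≤ ε ≤ 1`, `π ≥ 0`, `Σ π = 1`.
[cite: AndrieuLeeVihola2018, §3 Theorem 1 (proof)] -/
theorem lazyIndep_isRowStochastic (hπ : ∀ x, 0 ≤ π x) (hπ1 : ∑ x, π x = 1) {ε : ℝ}
    (hε0 : 0 ≤ ε) (hε1 : ε ≤ 1) :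
    IsRowStochastic (ε • limitMatrix π + (1 - ε) • (1 : Matrix X X ℝ)) := by
  refine ⟨fun x y => ?_, fun x => ?_⟩
  · rw [lazyIndep_apply]
    refine add_nonneg (mul_nonneg hε0 (hπ y)) (mul_nonneg (sub_nonneg.2 hε1) ?_)
    split_ifs <;> norm_num
  · simp_rw [lazyIndep_apply]
    rw [sum_add_distrib, ← mul_sum, hπ1, ← mul_sum, sum_ite_eq univ x, if_pos (mem_univ _)]
    ring

omit [Fintype X] in
/-- The lazy independent sampler is `π`-reversible. [cite: AndrieuLeeVihola2018, §3 Theorem 1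
(proof)] -/
theorem lazyIndep_detailedBalance (π : X → ℝ) (ε : ℝ) :
    DetailedBalance π (ε • limitMatrix π + (1 - ε) • (1 : Matrix X X ℝ)) := by
  intro x y
  rw [lazyIndep_apply, lazyIndep_apply]
  by_cases hxy : x = y
  · subst hxy; rfl
  · rw [if_neg hxy, if_neg (Ne.symm hxy)]
    ring

/-- The lazy independent sampler is irreducible (one step) for `ε > 0`, `π > 0`.
[cite: AndrieuLeeVihola2018, §3 Theorem 1 (proof)] -/
theorem lazyIndep_isIrreducible (hπ : ∀ x, 0 < π x) {ε : ℝ} (hε : 0 < ε) (hε1 : ε ≤ 1) :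
    IsIrreducible (ε • limitMatrix π + (1 - ε) • (1 : Matrix X X ℝ)) := fun x y =>
  ⟨1, by
    rw [pow_one, lazyIndep_apply]
    refine add_pos_of_pos_of_nonneg (mul_pos hε (hπ y)) (mul_nonneg (sub_nonneg.2 hε1) ?_)
    split_ifs <;> norm_num⟩

/-- **Fundamental matrix of the lazy independent sampler**: `Z(R_ε) = (I − (R_ε − A))⁻¹ =
ε⁻¹ I + (1 − ε⁻¹) A` (check: `(ε I + (1−ε) A)(ε⁻¹ I + (1−ε⁻¹) A) = I` using `A² = A`).
[cite: Peskun1973, §2.1 Definition 2.1.1 (the fundamental matrix)];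
[cite: AndrieuLeeVihola2018, §3 Theorem 1 (proof)] -/
theorem fundamentalMatrix_lazyIndep (hπ1 : ∑ x, π x = 1) {ε : ℝ} (hε : ε ≠ 0) :
    fundamentalMatrix π (ε • limitMatrix π + (1 - ε) • (1 : Matrix X X ℝ)) =
      ε⁻¹ • (1 : Matrix X X ℝ) + (1 - ε⁻¹) • limitMatrix π := by
  have hAA := limitMatrix_mul_self hπ1
  have h1 : (1 : Matrix X X ℝ) - (ε • limitMatrix π + (1 - ε) • (1 : Matrix X X ℝ) -
      limitMatrix π) = ε • (1 : Matrix X X ℝ) + (1 - ε) • limitMatrix π := by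
    ext x y
    rw [Matrix.sub_apply, Matrix.one_apply, Matrix.sub_apply, lazyIndep_apply, Matrix.add_apply,
      Matrix.smul_apply, Matrix.smul_apply, Matrix.one_apply]
    simp only [limitMatrix, of_apply, smul_eq_mul]
    split_ifs <;> ring
  have hprod : (ε • (1 : Matrix X X ℝ) + (1 - ε) • limitMatrix π) *
      (ε⁻¹ • (1 : Matrix X X ℝ) + (1 - ε⁻¹) • limitMatrix π) = 1 := by
    rw [add_mul, mul_add, mul_add, Matrix.smul_mul, Matrix.smul_mul, Matrix.smul_mul,
      Matrix.smul_mul, Matrix.mul_smul, Matrix.mul_smul, Matrix.mul_smul, Matrix.mul_smul,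
      Matrix.one_mul, Matrix.one_mul, Matrix.mul_one, hAA, smul_smul, smul_smul, smul_smul,
      smul_smul, mul_inv_cancel₀ hε, one_smul, add_assoc, ← add_smul, ← add_smul]
    have hc : ε * (1 - ε⁻¹) + ((1 - ε) * ε⁻¹ + (1 - ε) * (1 - ε⁻¹)) = 0 := by
      field_simp
      ring
    rw [hc, zero_smul, add_zero]
  unfold fundamentalMatrix
  rw [h1]
  exact inv_eq_right_inv hprod

/-- **Asymptotic variance of the lazy independent sampler**:
`v(f, π, R_ε) = (2ε⁻¹ − 1) · var_π(f)` (Kemeny–Snell's `v = 2⟨f, Zf⟩_π − ⟨f,f⟩_π − (πf)²` with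
`Z f = ε⁻¹ f + (1 − ε⁻¹) π(f)`). [cite: Peskun1973, §2.1 eq. (4), §2.3 (independent sampling,
`v(f, π, A) = var_π(f)`)]; [cite: AndrieuLeeVihola2018, §3 Theorem 1 (the constant
`2ε_N⁻¹ − 1`)] -/
theorem asympVar_lazyIndep (hπ1 : ∑ x, π x = 1) {ε : ℝ} (hε : ε ≠ 0) (f : X → ℝ) :
    asympVar f π (ε • limitMatrix π + (1 - ε) • (1 : Matrix X X ℝ)) =
      (2 * ε⁻¹ - 1) * (piInner π f f - (∑ x, π x * f x) ^ 2) := by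
  rw [asympVar_eq_sums, fundamentalMatrix_lazyIndep hπ1 hε]
  have hZ : ∀ x, ((ε⁻¹ • (1 : Matrix X X ℝ) + (1 - ε⁻¹) • limitMatrix π) *ᵥ f) x =
      ε⁻¹ * f x + (1 - ε⁻¹) * ∑ y, π y * f y := by
    intro x
    rw [add_mulVec, Matrix.smul_mulVec, Matrix.smul_mulVec, one_mulVec, Pi.add_apply,
      Pi.smul_apply, Pi.smul_apply, smul_eq_mul, smul_eq_mul, limitMatrix_mulVec_apply]
  obtain ⟨m, hm⟩ : ∃ m : ℝ, ∑ y, π y * f y = m := ⟨_, rfl⟩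
  unfold piInner
  simp_rw [hZ, hm]
  have e : ∑ x, π x * (f x * (ε⁻¹ * f x + (1 - ε⁻¹) * m)) =
      ε⁻¹ * ∑ x, π x * (f x * f x) + (1 - ε⁻¹) * m * m := by
    calc ∑ x, π x * (f x * (ε⁻¹ * f x + (1 - ε⁻¹) * m))
        = ∑ x, (ε⁻¹ * (π x * (f x * f x)) + (1 - ε⁻¹) * m * (π x * f x)) :=
          sum_congr rfl fun x _ => by ring
      _ = ε⁻¹ * ∑ x, π x * (f x * f x) + (1 - ε⁻¹) * m * ∑ x, π x * f x := by
          rw [sum_add_distrib, ← mul_sum, ← mul_sum]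
      _ = ε⁻¹ * ∑ x, π x * (f x * f x) + (1 - ε⁻¹) * m * m := by rw [hm]
  rw [e]
  ring

/-! ## The generic bound -/

/-- **Uniform minorisation by the target bounds the asymptotic variance**: if `P` is a
`π`-reversible stochastic matrix (`π > 0`, `Σ π = 1`) with `P(x, y) ≥ ε π(y)` for all `x, y`
(`ε > 0`), then `v(f, π, P) ≤ (2ε⁻¹ − 1) · var_π(f)` for every `f` — the Dirichlet form of `P`
dominates that of the lazy independent sampler `R_ε = ε A + (1−ε) I` entrywise off the diagonal,
and `v(f, π, R_ε) = (2ε⁻¹ − 1) var_π(f)`. [cite: AndrieuLeeVihola2018, §3 Theorem 1 (third display,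
upper bound, and its proof: "generic results on `π`-invariant Markov chains satisfying the
minorization `P_N(x,S) ≥ ε_N π(S)`")] -/
theorem asympVar_le_of_minorized (hπ : ∀ x, 0 < π x) (hπ1 : ∑ x, π x = 1) {P : Matrix X X ℝ}
    (hP : IsRowStochastic P) (hDB : DetailedBalance π P) {ε : ℝ} (hε : 0 < ε)
    (hmin : ∀ x y, ε * π y ≤ P x y) (f : X → ℝ) :
    asympVar f π P ≤ (2 * ε⁻¹ - 1) * (piInner π f f - (∑ x, π x * f x) ^ 2) := by
  obtain ⟨x₀⟩ : Nonempty X := by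
    rw [← not_isEmpty_iff]
    intro h
    rw [Finset.univ_eq_empty, Finset.sum_empty] at hπ1
    exact zero_ne_one hπ1
  have hε1 : ε ≤ 1 := by
    have h := sum_le_sum fun y (_ : y ∈ univ) => hmin x₀ y
    rwa [← mul_sum, hπ1, mul_one, hP.2 x₀] at h
  rw [← asympVar_lazyIndep hπ1 hε.ne' f]
  refine asympVar_le_of_dirichletForm_le hπ hπ1 hP
    (lazyIndep_isRowStochastic (fun x => (hπ x).le) hπ1 hε.le hε1) hDB
    (lazyIndep_detailedBalance π ε) (lazyIndep_isIrreducible hπ hε hε1)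
    (dirichletForm_mono (fun x => (hπ x).le) fun x y hxy => ?_) f
  rw [lazyIndep_apply, if_neg hxy, mul_zero, add_zero]
  exact hmin x y

/-! ## Instances: i-SIR (the cited theorem), MTM-IS, IMH -/

section Instances

variable {p q : X → ℝ} {W : ℝ}

/-- **Andrieu–Lee–Vihola's variance bound for i-SIR**: with `n + 1` fresh proposals per update
(pool size `N = n + 2`) and weights `p ≤ W q`, for every `f`,
`v(f, p, P_N) ≤ (2 ε_N⁻¹ − 1) · var_p(f)`, `ε_N = (N−1)/(2W+N−2) = (n+1)/(2W+n)`, i.e.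
`≤ [2(1 + (2W−1)/(N−1)) − 1] var_p(f)`. [cite: AndrieuLeeVihola2018, §1 (third bullet), §3
Theorem 1 (third display, upper bound)] -/
theorem asympVar_isir_le (hp : ∀ x, 0 < p x) (hp1 : ∑ x, p x = 1) (hq : ∀ x, 0 < q x)
    (hq1 : ∑ x, q x = 1) (n : ℕ) (hW : ∀ x, p x ≤ W * q x) (f : X → ℝ) :
    asympVar f p (isirKernel q p (n + 1) : Matrix X X ℝ) ≤
      (2 * ((n + 1) / (2 * W + n))⁻¹ - 1) * (piInner p f f - (∑ x, p x * f x) ^ 2) := by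
  obtain ⟨x₀⟩ : Nonempty X := by
    rw [← not_isEmpty_iff]
    intro h
    rw [Finset.univ_eq_empty, Finset.sum_empty] at hp1
    exact zero_ne_one hp1
  have hW0 : 0 < W := pos_of_mul_pos_left ((hp x₀).trans_le (hW x₀)) (hq x₀).le
  exact asympVar_le_of_minorized hp hp1 (isirKernel_isRowStochastic hp hq hq1 (n + 1))
    (isirKernel_detailedBalance hq (n + 1)) (by positivity)
    (fun x y => isirKernel_minorized hp hp1 hq hq1 n hW x y) f

/-- The same generic bound for MTM-IS(`n+1`), fed with Yang–Liu's minorisation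
`A(x, y) ≥ H_{n+1}(W) p(y)`: `v(f, p, A^{MTM}) ≤ (2/H_{n+1}(W) − 1) · var_p(f)`.
[cite: AndrieuLeeVihola2018, §3 Theorem 1 (upper variance bound under a uniform minorisation)];
[cite: YangLiu2021, §2.3 (the minorisation `A(x,dy) ≥ H_k(w⋆) π(y) dy`)] -/
theorem asympVar_mtmis_le (hp : ∀ x, 0 < p x) (hp1 : ∑ x, p x = 1) (hq : ∀ x, 0 < q x)
    (hq1 : ∑ x, q x = 1) (n : ℕ) (hW : ∀ x, p x ≤ W * q x) (f : X → ℝ) :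
    asympVar f p (mtmisKernel q p n : Matrix X X ℝ) ≤
      (2 * (mtmH q p n W)⁻¹ - 1) * (piInner p f f - (∑ x, p x * f x) ^ 2) := by
  obtain ⟨x₀⟩ : Nonempty X := by
    rw [← not_isEmpty_iff]
    intro h
    rw [Finset.univ_eq_empty, Finset.sum_empty] at hp1
    exact zero_ne_one hp1
  haveI : Nonempty X := ⟨x₀⟩
  have hW0 : 0 < W := pos_of_mul_pos_left ((hp x₀).trans_le (hW x₀)) (hq x₀).le
  exact asympVar_le_of_minorized hp hp1 (mtmisKernel_isRowStochastic hp hq hq1 n)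
    (mtmisKernel_detailedBalance hp hq n) (mtmH_pos hp hq n hW0)
    (fun x y => mtmisKernel_minorized hp hq n hW x y) f

/-- The same generic bound for the Metropolized independence sampler, fed with the
Mengersen–Tweedie minorisation `P(x, y) ≥ p(y)/W`: `v(f, p, P^{IMH}) ≤ (2W − 1) · var_p(f)`.
[cite: AndrieuLeeVihola2018, §3 Theorem 1 (upper variance bound under a uniform minorisation)];
[cite: MengersenTweedie1996, Thm 2.1 (the minorisation step)] -/
theorem asympVar_imh_le (hp : ∀ x, 0 < p x) (hp1 : ∑ x, p x = 1) (hq : ∀ x, 0 < q x)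
    (hq1 : ∑ x, q x = 1) (hW : ∀ x, p x ≤ W * q x) (f : X → ℝ) :
    asympVar f p (mhKernel (fun _ z => q z) p : Matrix X X ℝ) ≤
      (2 * W - 1) * (piInner p f f - (∑ x, p x * f x) ^ 2) := by
  obtain ⟨x₀⟩ : Nonempty X := by
    rw [← not_isEmpty_iff]
    intro h
    rw [Finset.univ_eq_empty, Finset.sum_empty] at hp1
    exact zero_ne_one hp1
  have hW0 : 0 < W := pos_of_mul_pos_left ((hp x₀).trans_le (hW x₀)) (hq x₀).le
  have h := asympVar_le_of_minorized hp hp1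
    (mhKernel_isRowStochastic (fun _ y => (hq y).le) (fun _ => hq1.le) hp)
    (mhKernel_detailedBalance hp fun _ z => q z) (inv_pos.2 hW0)
    (fun x y => imh_minorized hp (fun z => (hq z).le) hq1 hW x y) f
  rwa [inv_inv] at h

end Instances

end Literature.Probability.MarkovChains
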